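import Summits.CriticalPhenomena.SAWScalingLimit.Theorems.SAWLoopFugacityFlowIsingBoundaryRatioWindowRectBuild
import Summits.CriticalPhenomena.SAWScalingLimit.Theorems.SAWLoopFugacityFlowIsingBoundaryRatioWindowRectRoutes
import Literature.Probability.LatticeModels.MeshDomainBigComponents
import HarnessLib

/-!
# Window rectangle: walks of the mesh graph in the setting, and chart paths in the bulk
(line `fk-anchor-transfer`, crux `IsingBoundaryRatio`, stmt-CriticalPhenomena-10650; helper file of the stub
`windowRectPresentation_holds : WindowRectPresentation`)

Bookkeeping for the use of the shadowing field `WSetting.hshadow` of the static setting: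
* along a walk of the mesh graph through points of the domain starting at a vertex of `Ω_δ`, every site is a
  vertex of `Ω_δ` (`forall_mem_meshDomain_of_walk`); if moreover all sites are window sites and the walk starts
  in `S`, it ends in `S`, at a vertex of `E` unless it is trivial (`mem_S_of_walk`);
* chart paths in the bulk (`exists_path_arc_axis_arc`): two points `w, w'` of the upper half-plane are joined
  by "arc to the imaginary axis at radius `|w|`, along the axis, arc back at radius `|w'|`", a path whose
  points have norm between `min |w| |w'|` and `max |w| |w'|` and imaginary part at least
  `min (min (im w) (im w')) (min |w| |w'|)`.
[folklore]
-/

noncomputable section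

open scoped Classical Topology Real
open Filter Set Metric Complex
open Literature.Probability.LatticeModels Literature.Probability.RandomPlanarGeometry
open Literature.Probability.LatticeModels.DiscreteRect Literature.Topology.PlaneTopology
open UpperHalfPlane (upperHalfPlaneSet)

namespace Summit.CriticalPhenomena.SAWScalingLimit.Theorems.IsingBoundaryRatio

namespace WindowRect

/-! ### Walks of the mesh graph -/

/-- A point of `Ω` joined in the mesh graph to a vertex of `Ω_δ` is a vertex of `Ω_δ` (the tree's
`mem_meshDomain_of_meshGraph_adj` of `BoxCrossingProofs.lean` / the Cardy files, restated privately to keep the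
imports of this file small). [folklore] -/
private theorem mem_meshDomain_of_meshGraph_adj' {Ω : Set ℂ} {δ : ℝ} {x y : Site 2} (hx : x ∈ meshDomain Ω δ)
    (hy : meshPoint δ y ∈ Ω) (hxy : (meshGraph Ω δ).Adj x y) : y ∈ meshDomain Ω δ :=
  mem_meshDomain_of_reachable_meshVertexGraph hx (meshDomain_subset_meshVertices _ _ hx) hy
    (SimpleGraph.Adj.reachable (show (meshVertexGraph Ω δ).Adj ⟨x, _⟩ ⟨y, hy⟩ from hxy))

/-- **Along a walk of the mesh graph through points of `Ω` from a vertex of `Ω_δ`, every site is a vertex of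
`Ω_δ`.** [folklore] -/
theorem forall_mem_meshDomain_of_walk {Ω : Set ℂ} {δ : ℝ} :
    ∀ {x y : Site 2} (W : (meshGraph Ω δ).Walk x y), x ∈ meshDomain Ω δ →
      (∀ s ∈ W.support, meshPoint δ s ∈ Ω) → ∀ s ∈ W.support, s ∈ meshDomain Ω δ := by
  intro x y W
  induction W with
  | nil => intro hx _ s hs; rw [SimpleGraph.Walk.support_nil, List.mem_singleton] at hs; exact hs ▸ hx
  | @cons a b c h W ih =>
    intro ha hmem s hs
    rw [SimpleGraph.Walk.support_cons, List.mem_cons] at hs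
    rcases hs with rfl | hs
    · exact ha
    · have hb : b ∈ meshDomain Ω δ := mem_meshDomain_of_meshGraph_adj' ha
        (hmem b (by rw [SimpleGraph.Walk.support_cons]; exact List.mem_cons_of_mem _ W.start_mem_support)) h
      exact ih hb (fun t ht => hmem t (by rw [SimpleGraph.Walk.support_cons]; exact List.mem_cons_of_mem _ ht)) s hs

namespace WSetting

variable (X : WSetting)

/-- **A walk of the mesh graph through window sites from a site of `S` ends in `S`**, at a vertex of `E` unless
the walk is trivial. [folklore] -/
theorem mem_S_of_walk : ∀ {x y : Site 2} (W : (meshGraph X.D.carrier X.δ).Walk x y), x ∈ X.S →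
    (∀ s ∈ W.support, s ∈ X.Wset) → y ∈ X.S ∧ (y = x ∨ y ∈ verts X.E) := by
  intro x y W
  induction W with
  | nil => intro hx _; exact ⟨hx, Or.inl rfl⟩
  | @cons a b c h W ih =>
    intro ha hmem
    have hbW : b ∈ X.Wset := hmem b (by rw [SimpleGraph.Walk.support_cons]; exact List.mem_cons_of_mem _ W.start_mem_support)
    have hab : (discreteDomainGraph X.D.carrier X.δ).Adj a b :=
      discreteDomainGraph_adj_iff.2 ⟨h, X.mem_meshDomain_of_mem_S ha, hbW.1⟩
    have hb : b ∈ X.S := X.mem_S_of_adj ha hab hbW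
    obtain ⟨hc, hcb⟩ := ih hb fun s hs => hmem s (by rw [SimpleGraph.Walk.support_cons]; exact List.mem_cons_of_mem _ hs)
    refine ⟨hc, Or.inr ?_⟩
    rcases hcb with rfl | hcb
    · exact mem_verts_of_mem (X.E₀_subset_E (X.mem_E₀ ha hc hab))
    · exact hcb

end WSetting

/-! ### Chart paths in the bulk -/

/-- `circleMap 0 ‖w‖ (arg w) = w`. [folklore] -/
theorem circleMap_norm_arg (w : ℂ) : circleMap 0 ‖w‖ (arg w) = w := by
  rw [circleMap_zero]; exact norm_mul_exp_arg_mul_I w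

/-- `circleMap 0 R (π/2) = R i`. [folklore] -/
theorem circleMap_pi_div_two (R : ℝ) : circleMap 0 R (π / 2) = (R : ℂ) * I := by
  rw [circleMap_zero]; push_cast; rw [Complex.exp_pi_div_two_mul_I]

/-- The imaginary part of `circleMap 0 R θ` is `R sin θ`. [folklore] -/
theorem circleMap_zero_im (R θ : ℝ) : (circleMap 0 R θ).im = R * Real.sin θ := by
  simp [circleMap, Complex.exp_mul_I, Complex.cos_ofReal_re, Complex.sin_ofReal_re]

/-- **`sin` does not decrease towards `π/2`**: for `θ ∈ [0, π]` and `ψ` between `θ` and `π/2`,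
`sin θ ≤ sin ψ`. [folklore] -/
theorem sin_le_sin_of_between {θ ψ : ℝ} (h0 : 0 ≤ θ) (hπ : θ ≤ π) (hψ : ψ ∈ uIcc θ (π / 2)) :
    Real.sin θ ≤ Real.sin ψ := by
  rcases le_total θ (π / 2) with h | h
  · rw [uIcc_of_le h] at hψ
    exact Real.sin_le_sin_of_le_of_le_pi_div_two (by linarith [Real.pi_pos]) hψ.2 hψ.1
  · rw [uIcc_of_ge h] at hψ
    rw [← Real.sin_pi_sub θ, ← Real.sin_pi_sub ψ]
    exact Real.sin_le_sin_of_le_of_le_pi_div_two (by linarith) (by linarith [hψ.1]) (by linarith [hψ.2])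

/-- Points of the arc of the circle of radius `R = ‖w‖ > 0` from `w` (`im w ≥ 0`... `> 0`) to the top `R i` have
norm `R` and imaginary part `≥ im w`. [folklore] -/
theorem norm_im_of_mem_arc {w z : ℂ} (hw : 0 < w.im) (hz : z ∈ range (circleArc 0 ‖w‖ (arg w) (π / 2))) :
    ‖z‖ = ‖w‖ ∧ w.im ≤ z.im := by
  obtain ⟨ψ, hψ, rfl⟩ := exists_of_mem_arc hz
  have hw0 : 0 < ‖w‖ := norm_pos_iff.2 fun h => by rw [h] at hw; simp at hw
  refine ⟨by rw [norm_circleMap_zero, abs_of_pos hw0], ?_⟩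
  rw [circleMap_zero_im]
  have h1 := sin_le_sin_of_between (arg_nonneg_iff.2 hw.le) (arg_le_pi w) hψ
  rw [Complex.sin_arg, div_le_iff₀ hw0] at h1
  linarith

/-- **Arc – axis – arc paths in the upper half-plane.** [folklore] -/
theorem exists_path_arc_axis_arc {w w' : ℂ} (hw : 0 < w.im) (hw' : 0 < w'.im) :
    ∃ γ : Path w w', ∀ t, min ‖w‖ ‖w'‖ ≤ ‖γ t‖ ∧ ‖γ t‖ ≤ max ‖w‖ ‖w'‖ ∧
      min (min w.im w'.im) (min ‖w‖ ‖w'‖) ≤ (γ t).im := by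
  have hw0 : 0 < ‖w‖ := norm_pos_iff.2 fun h => by rw [h] at hw; simp at hw
  have hw0' : 0 < ‖w'‖ := norm_pos_iff.2 fun h => by rw [h] at hw'; simp at hw'
  set A := (circleArc 0 ‖w‖ (arg w) (π / 2)).cast (circleMap_norm_arg w).symm (circleMap_pi_div_two ‖w‖).symm
    with hA
  set B := ((circleArc 0 ‖w'‖ (arg w') (π / 2)).cast (circleMap_norm_arg w').symm (circleMap_pi_div_two ‖w'‖).symm).symm
    with hB
  set Sg := Path.segment ((‖w‖ : ℂ) * I) ((‖w'‖ : ℂ) * I) with hSg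
  refine ⟨(A.trans Sg).trans B, fun t => ?_⟩
  have ht : ((A.trans Sg).trans B) t ∈ range ((A.trans Sg).trans B) := mem_range_self t
  rw [Path.trans_range, Path.trans_range] at ht
  rcases ht with (ht | ht) | ht
  · rw [hA, Path.cast_coe] at ht
    obtain ⟨h1, h2⟩ := norm_im_of_mem_arc hw ht
    rw [h1]
    exact ⟨min_le_left _ _, le_max_left _ _, (min_le_left _ _).trans ((min_le_left _ _).trans h2)⟩
  · rw [hSg, Path.range_segment, segment_eq_image_lineMap] at ht
    obtain ⟨s, ⟨hs0, hs1⟩, hs⟩ := ht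
    rw [AffineMap.lineMap_apply_module] at hs
    have e : ((A.trans Sg).trans B) t = (((1 - s) * ‖w‖ + s * ‖w'‖ : ℝ) : ℂ) * I := by
      rw [← hs]; push_cast; simp [Complex.real_smul]; ring
    have hn : ‖((A.trans Sg).trans B) t‖ = (1 - s) * ‖w‖ + s * ‖w'‖ := by
      rw [e, norm_mul, norm_I, mul_one, norm_real, Real.norm_eq_abs, abs_of_nonneg (by positivity)]
    have hi : (((A.trans Sg).trans B) t).im = (1 - s) * ‖w‖ + s * ‖w'‖ := by rw [e]; simp
    rw [hn, hi]
    refine ⟨?_, ?_, (min_le_right _ _).trans ?_⟩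
    · nlinarith [min_le_left ‖w‖ ‖w'‖, min_le_right ‖w‖ ‖w'‖]
    · nlinarith [le_max_left ‖w‖ ‖w'‖, le_max_right ‖w‖ ‖w'‖]
    · nlinarith [min_le_left ‖w‖ ‖w'‖, min_le_right ‖w‖ ‖w'‖]
  · rw [hB, Path.symm_range, Path.cast_coe] at ht
    obtain ⟨h1, h2⟩ := norm_im_of_mem_arc hw' ht
    rw [h1]
    exact ⟨min_le_right _ _, le_max_right _ _, (min_le_left _ _).trans ((min_le_right _ _).trans h2)⟩

end WindowRect

/-- **Arc – axis – arc paths in the upper half-plane**, closed form (registered sub-goal of stmt-CriticalPhenomena-10650).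
[folklore] -/
theorem windowRect_exists_path_arc_axis_arc : ∀ {w w' : ℂ}, 0 < w.im → 0 < w'.im → ∃ γ : Path w w', ∀ t, min ‖w‖ ‖w'‖ ≤ ‖γ t‖ ∧ ‖γ t‖ ≤ max ‖w‖ ‖w'‖ ∧ min (min w.im w'.im) (min ‖w‖ ‖w'‖) ≤ (γ t).im :=
  fun hw hw' => WindowRect.exists_path_arc_axis_arc hw hw'

end Summit.CriticalPhenomena.SAWScalingLimit.Theorems.IsingBoundaryRatio

end
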